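import Literature.AlgebraicGeometry.Modules.PullbackUnitSections
import Literature.AlgebraicGeometry.Modules.PullbackAffineChart
import Literature.AlgebraicGeometry.Modules.SheafHomFunctor
import Literature.AlgebraicGeometry.Modules.PushforwardTrace
import HarnessLib

/-!
# The internal Hom and pull-back: the comparison `f^* 𝓗om(A, M) ⟶ 𝓗om(f^*A, f^*M)`

Layer `Literature/AlgebraicGeometry/Modules`; companion of `SheafHom.lean` (`𝓗om(A, M)`, `U ↦ Hom(A|_U, M|_U)`),
`SheafHomPushforward.lean` (the push-forward comparison `f_* 𝓗om(E, M) ⟶ 𝓗om(f_* E, f_* M)`) and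
`PullbackUnitSections.lean` (pulled-back sections `η(b)`, the double transpose). Everything PROVED, no named facts.

For ANY morphism of schemes `f : X ⟶ Y` and ANY `𝒪_Y`-modules `A`, `M` (Mathlib's `Scheme.Modules.pullback f = f^*`,
abstract — a left adjoint of `f_*`, no sectionwise formula):

* `pullbackHomOver f φ : (f^*A)|_{f⁻¹U} ⟶ (f^*M)|_{f⁻¹U}` for a local morphism `φ : A|_U ⟶ M|_U` — «`f^* φ`» on the
  restricted modules, CONSTRUCTED WITHOUT any base-change isomorphism `(f^*A)|_{f⁻¹U} ≅ (f|_U)^*(A|_U)`: it is the inverse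
  double transpose (`Modules/PullbackUnitSections`: restriction to the opens over `f⁻¹U` ⊣ `overExtend`, then `f^* ⊣ f_*`)
  of the sectionwise map `b ↦ η(φ(b|_{W ⊓ U}))` (`pullbackHomOverTranspose`); it is CHARACTERISED by its values on
  pulled-back sections, **`(f^*φ)(η(b)) = η(φ(b))`** (`appLE_pullbackHomOver_unitSection`), morphisms out of `(f^*A)|_{f⁻¹U}`
  being determined by their values on the `η(b)|` (`hom_ext_of_appLE_unitSection`); hence additive, `f♯`-semilinear
  (`pullbackHomOver_smul`), compatible with restriction (`restrictHom_pullbackHomOver`), with composition and identities,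
  and equal to `(f^* g)|_{f⁻¹U}` on `g|_U` for a global `g : A ⟶ M` (`pullbackHomOver_over_map`);
* **`sheafHomPullbackTransposeHom f A M : 𝓗om(A, M) ⟶ f_* 𝓗om(f^*A, f^*M)`** (`φ ↦ f^*φ` on sections) and its transpose
  **`sheafHomPullbackComparison f A M : f^* 𝓗om(A, M) ⟶ 𝓗om(f^*A, f^*M)`** — the canonical base-change morphism of the
  internal Hom (Görtz–Wedhorn I, (7.8.3) ∕ Exercise 7.20 (a): an isomorphism when `A` is locally free of finite rank — the
  isomorphism half is NOT proved here);
* naturality in `M` (`sheafHomMap`, covariant) of both: `sheafHomPullbackTransposeHom_naturality`,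
  `sheafHomPullbackComparison_naturality`; naturality in `A` for global morphisms at the level of sections
  (`pullbackHomOver_comp` with `pullbackHomOver_over_map`);
* compatibility with the units `𝒪 → 𝓔nd`: `sheafHomUnit A ≫ (φ ↦ f^*φ) = f♯ ≫ f_*(sheafHomUnit (f^*A))`
  (`sheafHomUnit_comp_sheafHomPullbackTransposeHom`; `f♯ = algebraUnit f` of `Modules/PushforwardTrace`).

Motivation: Road №4 of the Hodge atlas (crux stmt-HodgeConjecture-26512, support line «sigma-descent-along-q», library
item (L2) `SigmaPullbackCompat`, step (Q1) of its typing plan: the Hom-complex base change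
`𝓗om•(K, –) ⋙ q^*• ⟶ q^*• ⋙ 𝓗om•(q^*•K, –)` is this comparison summand by summand); nothing of that crux is asserted here.

## References

* U. Görtz, T. Wedhorn, *Algebraic Geometry I: Schemes*, 2nd ed. (2020), (7.8.3) and Exercise 7.20 (a) (the base-change map
  `f^*𝓗om(𝒢, 𝒢′) → 𝓗om(f^*𝒢, f^*𝒢′)`, an isomorphism for `𝒢` locally free of finite rank). [GortzWedhorn2020]
* The Stacks Project, Tag 01CM (Modules: internal Hom, functoriality). [StacksProject]
* R. Hartshorne, *Algebraic Geometry*, GTM 52 (1977), II.5 p. 110 (`f^*`, `f_*`, adjunction). [Hartshorne1977]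
-/

noncomputable section

-- `TopCat.Presheaf`/`Scheme.Modules` are not reducible (as in Mathlib's `AlgebraicGeometry/Modules/Sheaf.lean`).
set_option backward.isDefEq.respectTransparency false

open CategoryTheory AlgebraicGeometry Opposite TopologicalSpace Limits

universe u

namespace Literature.AlgebraicGeometry.Modules

variable {X Y : Scheme.{u}} (f : X ⟶ Y) {A M N : Y.Modules} {U : Y.Opens}

/-! ### Morphisms out of `(f^*A)|_{f⁻¹U}` are determined by their values on pulled-back sections -/

section Ext

/-- Restriction of sections of a module along a morphism of opens with a morphism in the opposite direction is
injective. [folklore] -/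
private theorem injective_presheaf_map_of_hom' (P : X.Modules) {V V' : X.Opens} (g : V ⟶ V') (g' : V' ⟶ V) :
    Function.Injective (P.presheaf.map g.op) := by
  intro a b h
  have key : ∀ c, P.presheaf.map g'.op (P.presheaf.map g.op c) = c := fun c => by
    rw [presheaf_map_map, Subsingleton.elim (g' ≫ g) (𝟙 _), op_id, P.presheaf.map_id]
    rfl
  have h1 : P.presheaf.map g'.op (P.presheaf.map g.op a) = P.presheaf.map g'.op (P.presheaf.map g.op b) := by rw [h]
  rwa [key, key] at h1

/-- `f⁻¹W ⟶ f⁻¹U × f⁻¹W` over `f⁻¹U` for `W ≤ U` (the inverse, in the thin category of opens, of the second projection).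
[folklore] -/
def preimageToProdHom {W : Y.Opens} (k : W ⟶ U) : f ⁻¹ᵁ W ⟶ ((f ⁻¹ᵁ U) ⨯ (f ⁻¹ᵁ W) : X.Opens) :=
  prod.lift ((Opens.map f.base).map k) (𝟙 _)

/-- For `W ≤ U`, the value of `γ : (f^*A)|_{f⁻¹U} → P|_{f⁻¹U}` on `η(b)|_{f⁻¹U × f⁻¹W}` (`b ∈ Γ(A, W)`) is the restriction of
its value on `η(b)` over `f⁻¹W`. [folklore] -/
private theorem val_app_star_map_unitSection {P : X.Modules}
    (γ : ((Scheme.Modules.pullback f).obj A).over (f ⁻¹ᵁ U) ⟶ P.over (f ⁻¹ᵁ U)) {W : Y.Opens} (k : W ⟶ U) (b : Γ(A, W)) :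
    γ.val.app (op ((Over.star (f ⁻¹ᵁ U)).obj (f ⁻¹ᵁ W)))
        (((Scheme.Modules.pullback f).obj A).presheaf.map (prod.snd : (f ⁻¹ᵁ U) ⨯ (f ⁻¹ᵁ W) ⟶ f ⁻¹ᵁ W).op (unitSection f A W b)) =
      P.presheaf.map (prod.snd : (f ⁻¹ᵁ U) ⨯ (f ⁻¹ᵁ W) ⟶ f ⁻¹ᵁ W).op
        (appLE γ ((Opens.map f.base).map k) (unitSection f A W b)) := by
  rw [appLE_def]
  exact PresheafOfModules.naturality_apply γ.val
    (Over.homMk (prod.snd : (f ⁻¹ᵁ U) ⨯ (f ⁻¹ᵁ W) ⟶ f ⁻¹ᵁ W) (Subsingleton.elim _ _) :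
      (Over.star (f ⁻¹ᵁ U)).obj (f ⁻¹ᵁ W) ⟶ Over.mk ((Opens.map f.base).map k)).op (unitSection f A W b)

/-- The double transpose of `γ` at ANY open `W` is computed from the value of `γ` on `η(b|_{W ⊓ U})` over `f⁻¹(W ⊓ U)`.
[folklore] -/
private theorem transpose_app_eq_map_appLE {P : X.Modules}
    (γ : ((Scheme.Modules.pullback f).obj A).over (f ⁻¹ᵁ U) ⟶ P.over (f ⁻¹ᵁ U)) (W : Y.Opens) (b : Γ(A, W)) :
    (transpose f A (f ⁻¹ᵁ U) γ).app W b =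
      P.presheaf.map (homOfLE (prod_le_preimage_inf (f := f) (U := U) W)).op
        (appLE γ ((Opens.map f.base).map (homOfLE (inf_le_right : W ⊓ U ≤ U)))
          (unitSection f A (W ⊓ U) (A.presheaf.map (homOfLE (inf_le_left : W ⊓ U ≤ W)).op b))) := by
  rw [transpose_app, appLE_def]
  -- `η(b)|_{U' × f⁻¹W} = η(b|_{W ⊓ U})|_{U' × f⁻¹W}`
  have hη : ((Scheme.Modules.pullback f).obj A).presheaf.map (prod.snd : (f ⁻¹ᵁ U) ⨯ (f ⁻¹ᵁ W) ⟶ f ⁻¹ᵁ W).op (unitSection f A W b) =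
      ((Scheme.Modules.pullback f).obj A).presheaf.map (homOfLE (prod_le_preimage_inf (f := f) (U := U) W)).op
        (unitSection f A (W ⊓ U) (A.presheaf.map (homOfLE (inf_le_left : W ⊓ U ≤ W)).op b)) := by
    rw [unitSection_map, presheaf_map_map]
    exact presheaf_map_congr _ _ _ _
  rw [hη]
  exact PresheafOfModules.naturality_apply γ.val
    (Over.homMk (homOfLE (prod_le_preimage_inf (f := f) (U := U) W)) (Subsingleton.elim _ _) :
      (Over.star (f ⁻¹ᵁ U)).obj (f ⁻¹ᵁ W) ⟶
        Over.mk ((Opens.map f.base).map (homOfLE (inf_le_right : W ⊓ U ≤ U)))).op _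

/-- **Uniqueness: a morphism `(f^*A)|_{f⁻¹U} → P|_{f⁻¹U}` is determined by its values on the pulled-back sections `η(b)`,
`b ∈ Γ(A, W)`, `W ≤ U`** (no frame needed: by the two adjunctions such morphisms correspond to morphisms
`A → f_*(overExtend P|_{f⁻¹U})`, whose sections are these values, `transpose_app_eq_map_appLE`). [cite: GortzWedhorn2020, (7.8.3) and Exercise 7.20 (a)] -/
theorem hom_ext_of_appLE_unitSection {P : X.Modules}
    {γ γ' : ((Scheme.Modules.pullback f).obj A).over (f ⁻¹ᵁ U) ⟶ P.over (f ⁻¹ᵁ U)}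
    (h : ∀ ⦃W : Y.Opens⦄ (k : W ⟶ U) (b : Γ(A, W)),
      appLE γ ((Opens.map f.base).map k) (unitSection f A W b) = appLE γ' ((Opens.map f.base).map k) (unitSection f A W b)) :
    γ = γ' := by
  apply transpose_injective f A (f ⁻¹ᵁ U)
  apply Scheme.Modules.hom_ext
  intro W
  ext b
  change (transpose f A (f ⁻¹ᵁ U) γ).app W b = (transpose f A (f ⁻¹ᵁ U) γ').app W b
  rw [transpose_app_eq_map_appLE, transpose_app_eq_map_appLE, h]

end Ext

/-! ### `f^*φ` on restricted modules: the inverse double transpose of `b ↦ η(φ(b|_{W ⊓ U}))` -/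

section PullbackOverHom

variable (φ : A.over U ⟶ M.over U)

/-- The sectionwise data `b ↦ η(φ(b|_{W ⊓ U}))|_{f⁻¹U × f⁻¹W}` (`b ∈ Γ(A, W)`, any open `W`). [folklore] -/
def pullbackHomOverFun (W : Y.Opens) (b : Γ(A, W)) : Γ((Scheme.Modules.pullback f).obj M, (f ⁻¹ᵁ U) ⨯ (f ⁻¹ᵁ W)) :=
  ((Scheme.Modules.pullback f).obj M).presheaf.map (homOfLE (prod_le_preimage_inf (f := f) (U := U) W)).op
    (unitSection f M (W ⊓ U) (appLE φ (homOfLE inf_le_right) (A.presheaf.map (homOfLE (inf_le_left : W ⊓ U ≤ W)).op b)))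

/-- `pullbackHomOverFun` is additive. [folklore] -/
private theorem pullbackHomOverFun_add (W : Y.Opens) (b b' : Γ(A, W)) :
    pullbackHomOverFun f φ W (b + b') = pullbackHomOverFun f φ W b + pullbackHomOverFun f φ W b' := by
  simp only [pullbackHomOverFun, map_add, appLE_add_right, unitSection_add]

/-- `pullbackHomOverFun` is compatible with restriction. [folklore] -/
private theorem pullbackHomOverFun_map {W W' : Y.Opens} (j : W' ⟶ W) (b : Γ(A, W)) :
    pullbackHomOverFun f φ W' (A.presheaf.map j.op b) =
      ((Scheme.Modules.pullback f).obj M).presheaf.map (prod.map (𝟙 _) ((Opens.map f.base).map j)).op (pullbackHomOverFun f φ W b) := by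
  have hl : W' ⊓ U ≤ W ⊓ U := inf_le_inf_right U j.le
  unfold pullbackHomOverFun
  rw [presheaf_map_map, Subsingleton.elim (homOfLE (inf_le_left : W' ⊓ U ≤ W') ≫ j)
    (homOfLE hl ≫ homOfLE (inf_le_left : W ⊓ U ≤ W)), ← presheaf_map_map,
    Subsingleton.elim (homOfLE (inf_le_right : W' ⊓ U ≤ U)) (homOfLE hl ≫ homOfLE inf_le_right), appLE_map,
    unitSection_map, presheaf_map_map, presheaf_map_map]
  exact presheaf_map_congr _ _ _ _

/-- `pullbackHomOverFun` is `f♯`-semilinear. [folklore] -/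
private theorem pullbackHomOverFun_smul (W : Y.Opens) (r : Γ(Y, W)) (b : Γ(A, W)) :
    pullbackHomOverFun f φ W (r • b) =
      X.presheaf.map (prod.snd : (f ⁻¹ᵁ U) ⨯ (f ⁻¹ᵁ W) ⟶ f ⁻¹ᵁ W).op (f.app W r) • pullbackHomOverFun f φ W b := by
  unfold pullbackHomOverFun
  rw [Scheme.Modules.map_smul, appLE_smul_right, unitSection_smul, Scheme.Modules.map_smul]
  congr 1
  change (Y.presheaf.map (homOfLE (inf_le_left : W ⊓ U ≤ W)).op ≫ f.app (W ⊓ U) ≫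
      X.presheaf.map (homOfLE (prod_le_preimage_inf (f := f) (U := U) W)).op) r =
    (f.app W ≫ X.presheaf.map (prod.snd : (f ⁻¹ᵁ U) ⨯ (f ⁻¹ᵁ W) ⟶ f ⁻¹ᵁ W).op) r
  rw [Scheme.Hom.app_eq_appLE, Scheme.Hom.app_eq_appLE, Scheme.Hom.appLE_map, Scheme.Hom.map_appLE, Scheme.Hom.appLE_map]

/-- **The double transpose of `f^*φ`**, as a morphism of `𝒪_Y`-modules `A → f_*(overExtend ((f^*M)|_{f⁻¹U}))`:
`b ↦ η(φ(b|_{W ⊓ U}))`. [folklore] -/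
def pullbackHomOverTranspose :
    A ⟶ (Scheme.Modules.pushforward f).obj ((overExtend (f ⁻¹ᵁ U)).obj (((Scheme.Modules.pullback f).obj M).over (f ⁻¹ᵁ U))) where
  val := PresheafOfModules.homMk
    { app := fun W => AddCommGrpCat.ofHom
        { toFun := fun b => (pullbackHomOverFun f φ W.unop b : Γ((Scheme.Modules.pullback f).obj M, (f ⁻¹ᵁ U) ⨯ (f ⁻¹ᵁ W.unop)))
          map_zero' := by
            have h := pullbackHomOverFun_add f φ W.unop 0 0
            rw [add_zero] at h
            exact left_eq_add.mp h
          map_add' := pullbackHomOverFun_add f φ W.unop }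
      naturality := fun {W W'} j => by
        ext b
        exact pullbackHomOverFun_map f φ j.unop b }
    (fun W r b => by
      change pullbackHomOverFun f φ W.unop (r • b) =
        X.presheaf.map (prod.snd : (f ⁻¹ᵁ U) ⨯ (f ⁻¹ᵁ W.unop) ⟶ f ⁻¹ᵁ W.unop).op (f.app W.unop r) •
          pullbackHomOverFun f φ W.unop b
      exact pullbackHomOverFun_smul f φ W.unop r b)

/-- Sections of `pullbackHomOverTranspose`. [folklore] -/
private theorem pullbackHomOverTranspose_app (W : Y.Opens) (b : Γ(A, W)) :
    (pullbackHomOverTranspose f φ).app W b = pullbackHomOverFun f φ W b := rfl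

/-- **`f^*φ : (f^*A)|_{f⁻¹U} ⟶ (f^*M)|_{f⁻¹U}` for a local morphism `φ : A|_U ⟶ M|_U`**, obtained from
`pullbackHomOverTranspose` by the two adjunctions (restriction ⊣ `overExtend`, `f^* ⊣ f_*`).
[cite: GortzWedhorn2020, (7.8.3) and Exercise 7.20 (a)] -/
def pullbackHomOver : ((Scheme.Modules.pullback f).obj A).over (f ⁻¹ᵁ U) ⟶ ((Scheme.Modules.pullback f).obj M).over (f ⁻¹ᵁ U) :=
  ((overAdj (f ⁻¹ᵁ U)).homEquiv _ _).symm
    (((Scheme.Modules.pullbackPushforwardAdjunction f).homEquiv _ _).symm (pullbackHomOverTranspose f φ))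

/-- The double transpose of `f^*φ` is `pullbackHomOverTranspose`. [folklore] -/
private theorem transpose_pullbackHomOver : transpose f A (f ⁻¹ᵁ U) (pullbackHomOver f φ) = pullbackHomOverTranspose f φ := by
  simp only [transpose, pullbackHomOver, Equiv.apply_symm_apply]

/-- **`(f^*φ)(η(b)) = η(φ(b))`** for `b ∈ Γ(A, W)`, `W ≤ U`: the values of `f^*φ` on pulled-back sections.
[cite: GortzWedhorn2020, (7.8.3) and Exercise 7.20 (a)] -/
theorem appLE_pullbackHomOver_unitSection {W : Y.Opens} (k : W ⟶ U) (b : Γ(A, W)) :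
    appLE (pullbackHomOver f φ) ((Opens.map f.base).map k) (unitSection f A W b) = unitSection f M W (appLE φ k b) := by
  -- both sides restricted to `f⁻¹U × f⁻¹W` agree with the double transpose at `b`
  apply injective_presheaf_map_of_hom' ((Scheme.Modules.pullback f).obj M)
    (prod.snd : (f ⁻¹ᵁ U) ⨯ (f ⁻¹ᵁ W) ⟶ f ⁻¹ᵁ W) (preimageToProdHom f k)
  rw [← val_app_star_map_unitSection, ← transpose_app, transpose_pullbackHomOver, pullbackHomOverTranspose_app]
  unfold pullbackHomOverFun
  rw [appLE_congr_hom φ (homOfLE (inf_le_right : W ⊓ U ≤ U)) (homOfLE (inf_le_left : W ⊓ U ≤ W) ≫ k), appLE_map,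
    unitSection_map, presheaf_map_map]
  exact presheaf_map_congr _ _ _ _

/-- `f^*(φ + φ') = f^*φ + f^*φ'`. [cite: GortzWedhorn2020, (7.8.3) and Exercise 7.20 (a)] -/
theorem pullbackHomOver_add (φ' : A.over U ⟶ M.over U) :
    pullbackHomOver f (φ + φ') = pullbackHomOver f φ + pullbackHomOver f φ' := by
  refine hom_ext_of_appLE_unitSection f fun W k b => ?_
  rw [appLE_add, appLE_pullbackHomOver_unitSection, appLE_pullbackHomOver_unitSection, appLE_pullbackHomOver_unitSection,
    appLE_add, unitSection_add]

/-- `f^* 0 = 0`. [cite: GortzWedhorn2020, (7.8.3) and Exercise 7.20 (a)] -/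
theorem pullbackHomOver_zero : pullbackHomOver f (0 : A.over U ⟶ M.over U) = 0 := by
  refine hom_ext_of_appLE_unitSection f fun W k b => ?_
  rw [appLE_pullbackHomOver_unitSection, appLE_zero, appLE_zero]
  exact map_zero _

/-- **`f^*` is `f♯`-semilinear on local morphisms**: `f^*(a • φ) = f♯(a) • f^*φ` for `a ∈ Γ(Y, U)`. [cite: GortzWedhorn2020, (7.8.3) and Exercise 7.20 (a)] -/
theorem pullbackHomOver_smul (a : Γ(Y, U)) : pullbackHomOver f (a • φ) = f.app U a • pullbackHomOver f φ := by
  refine hom_ext_of_appLE_unitSection f fun W k b => ?_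
  rw [appLE_pullbackHomOver_unitSection, appLE_smul, appLE_smul, appLE_pullbackHomOver_unitSection, unitSection_smul]
  congr 1
  change (Y.presheaf.map k.op ≫ f.app W) a = (f.app U ≫ X.presheaf.map ((Opens.map f.base).map k).op) a
  rw [Scheme.Hom.app_eq_appLE, Scheme.Hom.app_eq_appLE, Scheme.Hom.map_appLE, Scheme.Hom.appLE_map]

/-- **`f^*` commutes with restriction of local morphisms**: `(f^*φ)|_{f⁻¹V} = f^*(φ|_V)`. [cite: GortzWedhorn2020, (7.8.3) and Exercise 7.20 (a)] -/
theorem restrictHom_pullbackHomOver {V : Y.Opens} (i : V ⟶ U) :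
    restrictHom ((Opens.map f.base).map i) (pullbackHomOver f φ) = pullbackHomOver f (restrictHom i φ) := by
  refine hom_ext_of_appLE_unitSection f fun W k b => ?_
  rw [appLE_restrictHom, appLE_pullbackHomOver_unitSection, appLE_restrictHom]
  exact appLE_pullbackHomOver_unitSection f φ (k ≫ i) b

/-- `f^*(φ ≫ ψ) = f^*φ ≫ f^*ψ`. [cite: GortzWedhorn2020, (7.8.3) and Exercise 7.20 (a)] -/
theorem pullbackHomOver_comp (ψ : M.over U ⟶ N.over U) :
    pullbackHomOver f (φ ≫ ψ) = pullbackHomOver f φ ≫ pullbackHomOver f ψ := by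
  refine hom_ext_of_appLE_unitSection f fun W k b => ?_
  rw [appLE_comp, appLE_pullbackHomOver_unitSection, appLE_pullbackHomOver_unitSection, appLE_pullbackHomOver_unitSection,
    appLE_comp]

/-- `f^*(𝟙) = 𝟙`. [cite: GortzWedhorn2020, (7.8.3) and Exercise 7.20 (a)] -/
theorem pullbackHomOver_id : pullbackHomOver f (𝟙 (A.over U)) = 𝟙 _ := by
  refine hom_ext_of_appLE_unitSection f fun W k b => ?_
  rw [appLE_pullbackHomOver_unitSection, appLE_id, appLE_id]

/-- **On a global morphism `g : A ⟶ M`, `f^*(g|_U) = (f^*g)|_{f⁻¹U}`** (Mathlib's `(Scheme.Modules.pullback f).map g`, restricted).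
[cite: GortzWedhorn2020, (7.8.3) and Exercise 7.20 (a)] -/
theorem pullbackHomOver_over_map (g : A ⟶ M) :
    pullbackHomOver f ((SheafOfModules.overFunctor _ U).map g) =
      (SheafOfModules.overFunctor _ (f ⁻¹ᵁ U)).map ((Scheme.Modules.pullback f).map g) := by
  refine hom_ext_of_appLE_unitSection f fun W k b => ?_
  rw [appLE_pullbackHomOver_unitSection, appLE_over_map, appLE_over_map, pullback_map_app_unitSection]

/-- `f^*(a · 𝟙) = f♯(a) · 𝟙` (multiplication by a scalar). [cite: GortzWedhorn2020, (7.8.3) and Exercise 7.20 (a)] -/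
theorem pullbackHomOver_overScalar (a : Γ(Y, U)) :
    pullbackHomOver f (overScalar A U a) = overScalar ((Scheme.Modules.pullback f).obj A) (f ⁻¹ᵁ U) (f.app U a) := by
  have h : overScalar A U a = a • 𝟙 (A.over U) := by rw [smul_overHom_def, Category.id_comp]
  have h' : overScalar ((Scheme.Modules.pullback f).obj A) (f ⁻¹ᵁ U) (f.app U a) = f.app U a • 𝟙 _ := by
    rw [smul_overHom_def, Category.id_comp]
  rw [h, h', pullbackHomOver_smul, pullbackHomOver_id]

end PullbackOverHom

/-! ### The comparison morphisms `𝓗om(A, M) ⟶ f_* 𝓗om(f^*A, f^*M)` and `f^* 𝓗om(A, M) ⟶ 𝓗om(f^*A, f^*M)` -/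

section Comparison

variable (A M)

/-- **`𝓗om(A, M) ⟶ f_* 𝓗om(f^*A, f^*M)`, `φ ↦ f^*φ` on sections over every open `U ⊆ Y`** (a morphism of `𝒪_Y`-modules:
additive, `f♯`-semilinear, compatible with restriction). [cite: GortzWedhorn2020, (7.8.3) and Exercise 7.20 (a)]
[cite: StacksProject, Tag 01CM] -/
def sheafHomPullbackTransposeHom :
    sheafHom A M ⟶ (Scheme.Modules.pushforward f).obj (sheafHom ((Scheme.Modules.pullback f).obj A) ((Scheme.Modules.pullback f).obj M)) where
  val := PresheafOfModules.homMk
    { app := fun U => AddCommGrpCat.ofHom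
        { toFun := fun φ : A.over U.unop ⟶ M.over U.unop =>
            (pullbackHomOver f φ : ((Scheme.Modules.pullback f).obj A).over (f ⁻¹ᵁ U.unop) ⟶ ((Scheme.Modules.pullback f).obj M).over (f ⁻¹ᵁ U.unop))
          map_zero' := pullbackHomOver_zero f
          map_add' := fun φ φ' => pullbackHomOver_add f φ φ' }
      naturality := fun {U V} i => by
        refine AddCommGrpCat.ext fun (φ : A.over U.unop ⟶ M.over U.unop) => ?_
        exact (restrictHom_pullbackHomOver f φ i.unop).symm }
    (fun U (a : Γ(Y, U.unop)) (φ : A.over U.unop ⟶ M.over U.unop) => pullbackHomOver_smul f φ a)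

/-- Sections of `sheafHomPullbackTransposeHom`: `φ ↦ f^*φ`. [cite: GortzWedhorn2020, (7.8.3) and Exercise 7.20 (a)] -/
@[simp]
theorem sheafHomPullbackTransposeHom_app_apply (U : Y.Opens) (φ : A.over U ⟶ M.over U) :
    (sheafHomPullbackTransposeHom f A M).app U φ =
      (pullbackHomOver f φ : ((Scheme.Modules.pullback f).obj A).over (f ⁻¹ᵁ U) ⟶ ((Scheme.Modules.pullback f).obj M).over (f ⁻¹ᵁ U)) := rfl

/-- **THE BASE-CHANGE MORPHISM OF THE INTERNAL HOM `f^* 𝓗om(A, M) ⟶ 𝓗om(f^*A, f^*M)`** — the transpose of `φ ↦ f^*φ` under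
`f^* ⊣ f_*` (Görtz–Wedhorn I (7.8.3); an isomorphism for `A` locally free of finite rank, Exercise 7.20 (a) — not proved here).
[cite: GortzWedhorn2020, (7.8.3) and Exercise 7.20 (a)] [cite: Hartshorne1977, II.5 p. 110] -/
def sheafHomPullbackComparison :
    (Scheme.Modules.pullback f).obj (sheafHom A M) ⟶ sheafHom ((Scheme.Modules.pullback f).obj A) ((Scheme.Modules.pullback f).obj M) :=
  ((Scheme.Modules.pullbackPushforwardAdjunction f).homEquiv _ _).symm (sheafHomPullbackTransposeHom f A M)

/-- The transpose of the comparison is `φ ↦ f^*φ`. [cite: GortzWedhorn2020, (7.8.3) and Exercise 7.20 (a)] -/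
theorem homEquiv_sheafHomPullbackComparison :
    (Scheme.Modules.pullbackPushforwardAdjunction f).homEquiv _ _ (sheafHomPullbackComparison f A M) = sheafHomPullbackTransposeHom f A M := by
  simp only [sheafHomPullbackComparison, Equiv.apply_symm_apply]

variable {M}

/-- **Naturality in `M`** of `φ ↦ f^*φ`: for `g : M ⟶ N`, `𝓗om(A, g) ≫ (φ ↦ f^*φ) = (φ ↦ f^*φ) ≫ f_* 𝓗om(f^*A, f^*g)`.
[cite: StacksProject, Tag 01CM] -/
theorem sheafHomPullbackTransposeHom_naturality (g : M ⟶ N) :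
    sheafHomMap A g ≫ sheafHomPullbackTransposeHom f A N =
      sheafHomPullbackTransposeHom f A M ≫ (Scheme.Modules.pushforward f).map (sheafHomMap ((Scheme.Modules.pullback f).obj A) ((Scheme.Modules.pullback f).map g)) := by
  apply Scheme.Modules.hom_ext
  intro U
  ext φ
  change pullbackHomOver f (φ ≫ (SheafOfModules.overFunctor _ U).map g) =
    pullbackHomOver f φ ≫ (SheafOfModules.overFunctor _ (f ⁻¹ᵁ U)).map ((Scheme.Modules.pullback f).map g)
  rw [pullbackHomOver_comp, pullbackHomOver_over_map]

/-- **Naturality in `M`** of the comparison: `f^* 𝓗om(A, g) ≫ c_N = c_M ≫ 𝓗om(f^*A, f^*g)`. [cite: StacksProject, Tag 01CM] -/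
theorem sheafHomPullbackComparison_naturality (g : M ⟶ N) :
    (Scheme.Modules.pullback f).map (sheafHomMap A g) ≫ sheafHomPullbackComparison f A N =
      sheafHomPullbackComparison f A M ≫ sheafHomMap ((Scheme.Modules.pullback f).obj A) ((Scheme.Modules.pullback f).map g) := by
  apply ((Scheme.Modules.pullbackPushforwardAdjunction f).homEquiv _ _).injective
  rw [Adjunction.homEquiv_naturality_left, Adjunction.homEquiv_naturality_right, homEquiv_sheafHomPullbackComparison,
    homEquiv_sheafHomPullbackComparison, sheafHomPullbackTransposeHom_naturality]

variable (M)

/-- **Compatibility with the units**: `(𝒪_Y → 𝓔nd(A)) ≫ (φ ↦ f^*φ) = f♯ ≫ f_*(𝒪_X → 𝓔nd(f^*A))` (`a ↦ f^*(a · 𝟙) = f♯(a) · 𝟙`).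
[cite: GortzWedhorn2020, (7.8.3) and Exercise 7.20 (a)] [cite: StacksProject, Tag 0BVH] -/
theorem sheafHomUnit_comp_sheafHomPullbackTransposeHom :
    sheafHomUnit A ≫ sheafHomPullbackTransposeHom f A A =
      algebraUnit f ≫ (Scheme.Modules.pushforward f).map (sheafHomUnit ((Scheme.Modules.pullback f).obj A)) := by
  apply Scheme.Modules.hom_ext
  intro U
  ext a
  change pullbackHomOver f ((sheafHomUnit A).app U a) =
    (sheafHomUnit ((Scheme.Modules.pullback f).obj A)).app (f ⁻¹ᵁ U) ((algebraUnit f).app U a)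
  rw [sheafHomUnit_app_apply, sheafHomUnit_app_apply, algebraUnit_app_apply, pullbackHomOver_overScalar]

/-- The same on the `f^*` side: `f^*(𝒪_Y → 𝓔nd(A)) ≫ c = (f^*𝒪_Y → 𝒪_X) ≫ (𝒪_X → 𝓔nd(f^*A))` with `f^*𝒪_Y → 𝒪_X` the transpose
`f^*(f♯) ≫ ε` of the algebra unit (an isomorphism, `Modules/PullbackAlgebraUnit`). [cite: GortzWedhorn2020, (7.8.3) and Exercise 7.20 (a)]
[cite: StacksProject, Tag 01AK] -/
theorem pullback_map_sheafHomUnit_comp_sheafHomPullbackComparison :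
    (Scheme.Modules.pullback f).map (sheafHomUnit A) ≫ sheafHomPullbackComparison f A A =
      ((Scheme.Modules.pullback f).map (algebraUnit f) ≫ (Scheme.Modules.pullbackPushforwardAdjunction f).counit.app (unitModule X)) ≫
        sheafHomUnit ((Scheme.Modules.pullback f).obj A) := by
  rw [sheafHomPullbackComparison, ← Adjunction.homEquiv_naturality_left_symm, sheafHomUnit_comp_sheafHomPullbackTransposeHom,
    Adjunction.homEquiv_naturality_right_symm, Adjunction.homEquiv_counit]

end Comparison

end Literature.AlgebraicGeometry.Modules

end
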